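import Mathlib.Tactic
import HarnessLib
import HarnessLib.Audit.Tags
import Summits.CriticalPhenomena.PercolationContinuityZ3.Theorems.PercNearOneGluingNoHeavyLowerTailSahiRainbowMaxDichotomy

/-!
# The max-antichain accounting: private colours and the reduction to private-free position

Support file (seat `prim-masterthm-p1`, gen 39; `--supports stmt-CriticalPhenomena-4575`).  One typed statement and unconditional
reductions; no `sorry`, standard axioms.  Memo `run/shared/lean/prim/prim-masterthm/FROM-prim-masterthm-p1-g39-MAX-ACCOUNTING.md` §6.

SETTING (`…SahiRainbowMax`): complement-free antichain `A ⊆ 2^F`, admissible `X ⊆ A` (no member of `X` has its complement among the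
colours of `A`), `availColours F A X`; `AntichainAvailHall` (`#X ≤ #availColours F A X`) implies the rainbow lemma.

NEW HERE ([this work], gen 39).
* A colour `t ∈ availColours F A X` is PRIVATE to `x ∈ X` if `t ⊂ x` and no other member of `X` strictly contains `t`.  Removing `x` from
  `X` removes its private colours from the available ones and keeps the rest (`availColours_erase_subset`), so the Hall inequality for `X`
  follows from the one for `X.erase x` as soon as `x` owns a private colour (`card_availColours_erase_lt`).
* Hence (`antichainAvailHall_of_privateFree`) **`AntichainAvailHall` reduces to PRIVATE-FREE pairs** `(A, X)` — every available colour strictly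
  inside a member of `X` lies strictly inside at least two members of `X` — and there the inequality already holds in the sharper form
  `AntichainPrivateFreeHall` (typed, [status: open]): `#X ≤ #pfColours F A X`, where `pfColours` keeps only `∅`, the available colours lying
  strictly inside NO member of `A`, and the available MEETS OF `X` ITSELF (complemented joins inside members are not needed).  EVIDENCE:
  `AntichainPrivateFreeHall` holds for every private-free pair over all complement-free antichains of `2^5` (9 607 pairs) and `2^6`
  (5 283 756 pairs), engines `prim-masterthm-p1/code-g39/hall9.c`, `hall10.c`; equivalently (same data) the safe colours of `A` number at least
  `#X − #({∅} ∪ meets X) + #(blocked meets of X)`.  For `X = A` without blockers it says: if every complemented join lying strictly inside a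
  member lies strictly inside two members, then `#A ≤ #({∅} ∪ meets A) + #(safe colours)` (there, an injection of the doubly-swallowed
  complemented joins into the meets that are not complemented joins exists in all data: `h0.c`).
* `rainbowMeetCojoin_of_privateFreeHall`: **`AntichainPrivateFreeHall ⟹ RainbowMeetCojoin`**.
HONEST FRAMING: `AntichainPrivateFreeHall`, `AntichainAvailHall`, `RainbowMeetCojoin` remain OPEN; the reductions are unconditional. [this work]
-/

namespace Summit.CriticalPhenomena.PercolationContinuityZ3.Theorems.SahiColouredDaykin

open Finset

variable {α : Type*} [DecidableEq α]

/-! ### 1. Monotonicity and private colours -/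

section Private

variable {F : Finset α} {A X : Finset (Finset α)}

/-- The available colours are monotone in `X`. [this work] -/
theorem availColours_mono (F : Finset α) (A : Finset (Finset α)) {X Y : Finset (Finset α)} (h : X ⊆ Y) :
    availColours F A X ⊆ availColours F A Y := by
  intro t ht
  obtain ⟨hR, hσ, hor⟩ := mem_availColours_iff.1 ht
  refine mem_availColours_iff.2 ⟨hR, hσ, ?_⟩
  rcases hor with h0 | ⟨x, hx, htx⟩
  · exact Or.inl h0
  · exact Or.inr ⟨x, h hx, htx⟩

/-- A colour private to `x ∈ X` (strictly inside `x` and inside no other member of `X`) is not available to `X.erase x`. [this work] -/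
theorem not_mem_availColours_erase {x t : Finset α} (hxA : x ∈ A) (htx : t ⊂ x)
    (hpriv : ∀ x' ∈ X, x' ≠ x → ¬ t ⊂ x') : t ∉ availColours F A (X.erase x) := by
  intro ht
  obtain ⟨_, _, hor⟩ := mem_availColours_iff.1 ht
  rcases hor with h0 | ⟨x', hx', htx'⟩
  · exact h0 x hxA htx
  · exact hpriv x' (mem_of_mem_erase hx') (ne_of_mem_erase hx') htx'

/-- **Removing the owner of a private colour.**  If `x ∈ X` owns a private available colour, then `X.erase x` has strictly fewer available
colours than `X`. [this work] -/
theorem card_availColours_erase_lt {x t : Finset α} (hxA : x ∈ A) (ht : t ∈ availColours F A X) (htx : t ⊂ x)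
    (hpriv : ∀ x' ∈ X, x' ≠ x → ¬ t ⊂ x') : #(availColours F A (X.erase x)) < #(availColours F A X) := by
  apply card_lt_card
  refine ⟨availColours_mono F A (erase_subset x X), fun hsub => ?_⟩
  exact not_mem_availColours_erase hxA htx hpriv (hsub ht)

end Private

/-! ### 2. Private-free pairs and the typed statement -/

/-- The colours that pay a private-free `X`: the available colours that are `∅`, or lie strictly inside no member of `A`, or are meets of two
members of `X`. [this work] -/
def pfColours (F : Finset α) (A X : Finset (Finset α)) : Finset (Finset α) :=
  (availColours F A X).filter fun t => t = ∅ ∨ (∀ a ∈ A, ¬ t ⊂ a) ∨ t ∈ meets X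

/-- `pfColours ⊆ availColours`. [this work] -/
theorem pfColours_subset (F : Finset α) (A X : Finset (Finset α)) : pfColours F A X ⊆ availColours F A X := filter_subset _ _

/-- The pair `(A, X)` is PRIVATE-FREE: every available colour strictly inside a member of `X` lies strictly inside another member of `X`.
[this work] -/
def PrivateFree (F : Finset α) (A X : Finset (Finset α)) : Prop :=
  ∀ x ∈ X, ∀ t ∈ availColours F A X, t ⊂ x → ∃ x' ∈ X, x' ≠ x ∧ t ⊂ x'

/-- **CONJECTURE (Hall condition in private-free position; typed).**  For a complement-free antichain `A ⊆ 2^F` and an admissible,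
private-free `X ⊆ A`: `#X ≤ #pfColours F A X`.  Exhaustive on `2^5` and `2^6` (file header); implies `AntichainAvailHall`
(`antichainAvailHall_of_privateFree`). [this work] [status: open] -/
@[conjecture] def AntichainPrivateFreeHall (α : Type*) [DecidableEq α] : Prop :=
  ∀ (F : Finset α) (A X : Finset (Finset α)),
    (∀ a ∈ A, a ⊆ F) → (∀ a ∈ A, F \ a ∉ A) → IsAntichain (· ⊆ ·) (A : Set (Finset α)) →
    X ⊆ A → (∀ x ∈ X, F \ x ∉ rainbowMeets F A) → PrivateFree F A X →
    #X ≤ #(pfColours F A X)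

/-! ### 3. The reduction -/

/-- **`AntichainPrivateFreeHall ⟹ AntichainAvailHall`**: induct on `#X`; an owner of a private colour is removed (the private colour is lost,
nothing else), and a private-free `X` is paid by `pfColours ⊆ availColours`. [this work] -/
theorem antichainAvailHall_of_privateFree (h : AntichainPrivateFreeHall α) : AntichainAvailHall α := by
  intro F A X hAF hcf hanti
  -- induction on the size of `X`
  suffices H : ∀ n (Y : Finset (Finset α)), #Y = n → Y ⊆ A → (∀ x ∈ Y, F \ x ∉ rainbowMeets F A) →
      #Y ≤ #(availColours F A Y) from fun hXA hX => H _ X rfl hXA hX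
  intro n
  induction n with
  | zero => intro Y hY _ _; rw [hY]; exact Nat.zero_le _
  | succ n ih =>
    intro Y hY hYA hYσ
    by_cases hpf : PrivateFree F A Y
    · exact (h F A Y hAF hcf hanti hYA hYσ hpf).trans (card_le_card (pfColours_subset F A Y))
    · -- some member owns a private colour
      unfold PrivateFree at hpf
      push Not at hpf
      obtain ⟨x, hxY, t, ht, htx, hpriv⟩ := hpf
      have hlt := card_availColours_erase_lt (hYA hxY) ht htx (fun x' hx' hne => hpriv x' hx' hne)
      have hcard : #(Y.erase x) = n := by rw [card_erase_of_mem hxY, hY]; rfl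
      have := ih (Y.erase x) hcard ((erase_subset x Y).trans hYA) (fun y hy => hYσ y (mem_of_mem_erase hy))
      omega

/-- **`AntichainPrivateFreeHall ⟹ RainbowMeetCojoin`.** [this work] -/
theorem rainbowMeetCojoin_of_privateFreeHall (h : AntichainPrivateFreeHall α) : RainbowMeetCojoin α :=
  rainbowMeetCojoin_of_antichainAvailHall (antichainAvailHall_of_privateFree h)

end Summit.CriticalPhenomena.PercolationContinuityZ3.Theorems.SahiColouredDaykin
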